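import Summits.QuantumFields.YangMills.Theorems.LuscherReductionTwistedTraceScalingBOLocalisedAvgChartLower
import Summits.QuantumFields.YangMills.Theorems.LuscherReductionTwistedTraceScalingBOCentralGlueInner
import HarnessLib

/-!
# (C1-β) ★★★ THE CENTRAL TRANSFER AT INNER-CORE FIBRE POINTS IS TWO-SIDED BY THE STIFF GAUSSIAN PROFILE — (C1) as a theorem modulo (P) and the toolchain smallness list
# (lane A of S-BASE, crux `TwistedTraceScaling` stmt-QuantumFields-20203, C4-CORE, the (OD) pen; `pub/ym-fleet/ym-luscher-20007-p1/COARSE-DESIGN.md` §27.9, §28)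

★★★ `central_transfer_two_sided_chart` — for ANY bounded measurable `Ω ≥ 0` with `boFun χ₀ Ω = boFun χ₀ Ω_G` (the glue's support hypothesis `hΩt` wants `supp(Ω∘linkEmbed) ⊆ capBalancedSet`,
which the literal `Ω_G = frozenProfile` violates but its restriction to `linkEmbed(capBalancedSet)` satisfies, with the same BO functions since `relLinkVec` of a tube point is cap-balanced):
`…BOCentralGlueInner.central_transfer_two_sided_of_localisedAvg_inner` with hAlo := `…BOLocalisedAvgChartLower.localisedAvg_chart_lower`
(`R_w = R_in + R₀`, core-complement part exactly zero) and hAhi := `…BOLocalisedAvgChartUpper.localisedAvg_chart_upper`, at `(t,b) = (β/2, β)`: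
  `lo·stiffGaussTop·e^{−q(linkEmbed v')}/I₀ ≤ T₁(v') ≤ hi·stiffGaussTop·e^{−q(linkEmbed v')}/I₀`
with `lo = e^{−η₀}·c_lo·g_m·(e^{−882βT²R_in²} − e^{49βR_in²}·tail/stiffGaussTop)`, `hi = e^{η₀}·(c_hi·g_p·e^{882βT²R_in²} + C_χ·far·e^{49βR_in²}/stiffGaussTop)`,
`g_m = Z·χ_lo·e^{−(ε_q+ε_tr)}(N_lo − T_b)`, `g_p = Z·C_χ·(e^{ε_q'+ε_tr'}N_hi + T_b·e^{49β|E|ρ²})` — every quantity explicit in the statement.  The remaining hypotheses are (P)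
(`N_lo ≤ N ≤ N_hi` on the fat tube: `…FPWeightCore.fpWeight_core_constant_pow`), the (N2) toolchain data, and the smallness list of the radii — all eventually true on schedule B
(rates file to come: `ρ = 128Lβ^{-1/2}ℓ²`, `r = β^{-1}ℓ³`, `R₁' = 5β^{-1/2}ℓ²`, `r_f = β^{-1/2}ℓ`, `R_in = r_f/12`, `R₀ = 0.83r_f`, `ℓ = btLog β`).
HONEST FRAMING: (C1) for a stub of a child of the CONDITIONAL route R2b1, conditional on (P) + smallness; rates, (C4), (C5), (B-ST) OPEN; C4-CORE OPEN; not infinite volume, not a gap, not Clay.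
-/

set_option autoImplicit false

noncomputable section

open MeasureTheory Filter Topology Real
open scoped BigOperators RealInnerProductSpace
open Literature.MathematicalPhysics.QuantumFieldTheory
open Literature.MathematicalPhysics.QuantumLattice

namespace Summit.QuantumFields.YangMills.Theorems.FemtoTransferGap.TwoLattice.ConstTube

open Summit.QuantumFields.YangMills.Theorems.FemtoTransferGap
open Summit.QuantumFields.YangMills.Theorems.FemtoTransferGap.TwoLattice
open Summit.QuantumFields.YangMills.Theorems.FemtoTransferGap.TwoLattice.Avg
open Summit.QuantumFields.YangMills.Theorems.FemtoTransferGap.TwoLattice.Stiff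
open Summit.QuantumFields.YangMills.Theorems.FemtoTransferGap.TwoLattice.GnChart

variable {L : ℕ} [NeZero L]

/-- ★★★ **(C1) AT INNER-CORE FIBRE POINTS, FROM (P) AND THE (N2) TOOLCHAIN ALONE.**  For the profile of record `Ω_G = frozenProfile L q_f r_f β` (`q_f β = q_{β/2,β}`), the weight
`W = coreWeight ε R₁'` (colour FP constant `Z`), a class-function window amplitude `χ₀` (floor `χ_lo` on the `5Mδ`-window, ceiling `C_χ`), a fibre point `v'` of the INNER core
`‖linkEmbed v'‖ ≤ R_in` of the support ball (radius `R`), the two-sided bounds `N_lo ≤ N ≤ N_hi` of the Faddeev–Popov weight on the fat tube ((P)), and the displayed smallness of the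
radii `ρ, r, R₁, ρ₁, R₀`: the central transfer `T₁(v') = fpFibreTransfer β Ω_G W (orthoTube L 1 v') 1` is two-sided by explicit multiples of `stiffGaussTop·e^{−q(linkEmbed v')}/I₀`
(`…BOCentralGlueInner.central_transfer_two_sided_of_localisedAvg_inner` fed with `…BOLocalisedAvgChartLower/Upper`). [cite: Luscher1983, §3] [cite: Wipf2021, §8.5.2] -/
theorem central_transfer_two_sided_chart (hL : Nonempty (NzSite L)) {s K M : ℝ} {β : ℝ} (hβ : 0 < β) (hs1 : 0 < powScale 1 β)
    -- the toolchain
    {Ksp εsp : ℝ} (hKsp : 0 ≤ Ksp)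
    (hSP : ∀ w : Edge 3 L → Fin 3 → ℝ, w ∈ balancedSet L → ∀ c : Fin 3 → Fin 3 → ℝ, ‖w‖ < εsp → ‖c‖ < εsp →
      ∃ ξ : Site 3 L → Fin 3 → ℝ, ∑ x : Site 3 L, ξ x = 0 ∧ ‖ξ‖ ≤ Ksp * ‖w‖ ∧
        gaugeCoordSq L (gaugeTransform (fun x => chartSU2 (ξ x)) (orthoTube L (fun e₁ => chartSU2 (c e₁.2)) w)) = 0)
    {εT MT : ℝ} (hMT : 0 ≤ MT) (hεT : 0 < εT)
    (hT : ∀ (ξ : basedSubmodule L) (q : balancedSubmodule L × (Fin 3 → Fin 3 → ℝ)), ‖ξ‖ < εT → ‖q‖ < εT →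
      ‖basedFn L (ξ, q) - basedFn L (0, q) - basedLin L q ξ‖ ≤ MT * ‖ξ‖ ^ 2)
    {εC : ℝ} (hC : ∀ q : balancedSubmodule L × (Fin 3 → Fin 3 → ℝ), ‖q‖ < εC →
      ∀ ξ : basedSubmodule L, ‖ξ‖ ≤ 4 * sliceConst L * ‖(gaugeModes L).starProjection (basedLin L q ξ)‖)
    {εI : ℝ} (hI : ∀ q : balancedSubmodule L × (Fin 3 → Fin 3 → ℝ), ‖q‖ < εI → ∀ {a s' : ℝ}, 0 < a → 0 < s' →
      ∫ w, Real.exp (-(a * ‖laplaceMap L q w‖ ^ 2 / s' ^ 2)) ∂(volume : Measure (NzSite L → Fin 3 → ℝ)) =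
        (π * s' ^ 2 / a) ^ (flatDim L / 2 : ℝ) / Real.sqrt (gramDet L q))
    {KD εD : ℝ} (hKD : 0 ≤ KD) (hD : ∀ q : balancedSubmodule L × (Fin 3 → Fin 3 → ℝ), ‖q‖ < εD → |gramDet L q / gramDet L 0 - 1| ≤ KD * ‖q‖ ^ 2)
    {B εB : ℝ} (hB0 : 0 ≤ B) (hB : ∀ q : balancedSubmodule L × (Fin 3 → Fin 3 → ℝ), ‖q‖ < εB → ‖basedLin L q‖ ≤ B)
    {CL εL : ℝ} (hCL : 0 ≤ CL)
    (hLip : ∀ q : balancedSubmodule L × (Fin 3 → Fin 3 → ℝ), ‖q‖ < εL → ∀ ξ : basedSubmodule L, ‖(basedLin L q - basedLin L 0) ξ‖ ≤ CL * ‖q‖ * ‖ξ‖)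
    -- the profile, the amplitude, the weight
    {qf : ℝ → LinkSpace L → ℝ} (hqfm : ∀ β', Measurable (qf β')) (hqf0 : ∀ β' x, 0 ≤ qf β' x)
    (hqfinv : ∀ β' (g : SU2) (x : LinkSpace L), qf β' (adL L g x) = qf β' x) (hqf : qf β = stiffGaussExp L (β / 2) β) {rf : ℝ → ℝ}
    {χ₀ : GaugeConfig 3 1 SU2 → ℝ} (hχm : Measurable χ₀) {Cχ : ℝ} (hχ0 : ∀ u, 0 ≤ χ₀ u) (hCχ : ∀ u, χ₀ u ≤ Cχ)
    (hχinv : ∀ (c : SU2) (u : GaugeConfig 3 1 SU2), χ₀ (gaugeTransform (fun _ : Site 3 1 => c) u) = χ₀ u)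
    (hbo : ∀ U, boFun L χ₀ (frozenProfile L qf rf β) U ≠ 0 → recordChi L s K M β U ≠ 0)
    -- the profile actually transferred: any bounded measurable `Ω ≥ 0` with the same BO functions as `Ω_G` (e.g. `Ω_G` restricted to `linkEmbed(capBalancedSet)`)
    {Ω : LinkSpace L → ℝ} (hΩm : Measurable Ω) {CΩ : ℝ} (hCΩ : ∀ x, |Ω x| ≤ CΩ) (hΩ0 : ∀ x, 0 ≤ Ω x) (hΩbo : boFun L χ₀ Ω = boFun L χ₀ (frozenProfile L qf rf β))
    {ε R₁' : ℝ} {Z : ℝ} (hZ0 : 0 ≤ Z) (hZ : ∀ g : Site 3 L → SU2, ∫ c, fpWeight L ε (fun x => c * g x) ∂haarProbability SU2 = Z)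
    -- the glue data: window, support, weight support, fibre point
    {δu T R Γ σ : ℝ} (hδu1 : δu ≤ 1) (hT0 : 0 ≤ T) (hT30 : T ≤ 1 / 30) (hσ0 : 0 ≤ σ) (hσ : σ < 2)
    (hΩt : ∀ v : Edge 3 L → Fin 3 → ℝ, Ω (linkEmbed L v) ≠ 0 → v ∈ capBalancedSet L ∧ (∀ (e : Edge 3 L) (c : Fin 3), |v e c| ≤ T) ∧ ‖linkEmbed L v‖ ≤ R)
    (hWc : ∀ g : Site 3 L → SU2, coreWeight L ε R₁' g ≠ 0 → (∀ x, ‖su2Quat (g x) - 1‖ ≤ T) ∧ ‖∑ x, vecPart (g x)‖ ≤ Γ)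
    (hχw : ∀ u, χ₀ u ≠ 0 → (∀ k : Fin 3, ‖su2Quat (u (0, k)) - 1‖ ≤ δu) ∧ (L : ℝ) ^ 3 * wilsonAction su2Rep u ≤ σ)
    (hI0 : 0 < ∫ u, χ₀ u * (transferKernel su2Rep ((L : ℝ) ^ 3 * β) (1 : GaugeConfig 3 1 SU2) u / transferKernel su2Rep ((L : ℝ) ^ 3 * β) (1 : GaugeConfig 3 1 SU2) 1)
      ∂configMeasure SU2 1)
    {v' : Edge 3 L → Fin 3 → ℝ} (hv' : v' ∈ capBalancedSet L) (hv'T : ∀ (e : Edge 3 L) (c : Fin 3), |v' e c| ≤ T) {Rin : ℝ} (hx' : ‖linkEmbed L v'‖ ≤ Rin) (hRin : Rin ≤ R)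
    -- (P): the Faddeev–Popov weight on the fat tube
    {Nlo Nhi : ℝ} (hNlo : ∀ U ∈ fatTubeRho L (fun b' => K * powScale s b') (fun b' => M * (K * powScale s b')) β, Nlo ≤ gaugeAvg (recordChi L s K M β) U)
    (hNhi : ∀ U ∈ fatTubeRho L (fun b' => K * powScale s b') (fun b' => M * (K * powScale s b')) β, gaugeAvg (recordChi L s K M β) U ≤ Nhi)
    -- radii and their smallness
    {ρ r R₁ ρ₁ R₀ : ℝ} (hρ : 0 < ρ) (hρ5 : ρ ≤ 1 / 5) (hTρ : 8 * T ≤ ρ) (hR₀ : 6 * T ^ 2 * Rin ≤ R₀)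
    (hρε : 3 * ρ < εsp) (hρK : 3 * Ksp * ρ ≤ 1 / 8) (hR50 : ((2 + 24 * Ksp) * ρ) ^ 2 / 4 ≤ 1 / 50)
    (h1 : (4 + 48 * Ksp) * ρ < εT) (h2 : (4 + 48 * Ksp) * ρ < εL) (h3 : (4 + 48 * Ksp) * ρ < εB) (h4 : (4 + 48 * Ksp) * ρ ≤ 1 / 40) (h5 : 9 * Ksp * ρ < εT)
    (h6 : (4 + 48 * Ksp) * ρ < εC) (h7 : (4 + 48 * Ksp) * ρ < εI) (h8 : (4 + 48 * Ksp) * ρ < εD) (h9 : KD * ((4 + 48 * Ksp) * ρ) ^ 2 ≤ 1 / 2)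
    (hδ : Real.sqrt 2 * Fintype.card (Edge 3 L) * ρ < K * powScale s β) (hρf : Real.sqrt 2 * ρ < M * (K * powScale s β)) (hρ₁ : (2 + 24 * Ksp) * ρ < ρ₁)
    (hr0 : 0 ≤ r) (hrR : r ≤ R₁) (hR1 : R₁ ≤ 1 / 2) (hR1T : R₁ < εT) (hcore : ρ₁ + 8 * r ≤ M * (K * powScale s β))
    (hsupp : 3 * ((L : ℝ) - 1) * (ρ₁ + M * (K * powScale s β)) ≤ R₁) (hθ : (MT + 2 * B) * R₁ * (4 * sliceConst L) ≤ 1 / 4)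
    (hρ4 : M * (K * powScale s β) ≤ 1 / 4)
    {χlo : ℝ} (hχlo0 : 0 ≤ χlo)
    (hχlo : ∀ u : GaugeConfig 3 1 SU2, (∀ k : Fin 3, ‖su2Quat (u (0, k)) - 1‖ ≤ 5 * (M * (K * powScale s β))) →
      wilsonAction su2Rep u ≤ 12 * (5 * (M * (K * powScale s β))) ^ 4 → χlo ≤ χ₀ u)
    (hrf : (Rin + R₀) + 14 * Fintype.card (Edge 3 L) * ρ ^ 2 + (CL * ((4 + 48 * Ksp) * ρ) * (9 * Ksp * ρ) + MT * (9 * Ksp * ρ) ^ 2) + (B * r + MT * r ^ 2) ≤ rf β)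
    (ha'3 : 9 * Ksp * ρ ≤ 1 / 3) (hboot' : 4 * sliceConst L * MT * (9 * Ksp * ρ) ≤ 1 / 2)
    (hRb3 : 3 * ((L : ℝ) - 1) * (ρ₁ + M * (K * powScale s β)) ≤ 1 / 3) (hRbT : 3 * ((L : ℝ) - 1) * (ρ₁ + M * (K * powScale s β)) < εT)
    (hbootb : 4 * sliceConst L * MT * (3 * ((L : ℝ) - 1) * (ρ₁ + M * (K * powScale s β))) ≤ 1 / 2)
    (hjump : 32 * sliceConst L * (((Rin + R₀) + 14 * Fintype.card (Edge 3 L) * ρ ^ 2) + rf β) < R₁')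
    (hNT : ((1 + KD * ((4 + 48 * Ksp) * ρ) ^ 2) * (4 : ℝ) ^ (flatDim L / 2 : ℝ) * Real.exp (-((1 / (4 * sliceConst L)) ^ 2 * r ^ 2 / (4 * (powScale 1 β) ^ 2))) * fpWeightBar L (powScale 1 β)) ≤ Nlo) :
    Real.exp (-(coreEta L β 0 δu T R Γ σ + coreEps1 L β 0 T R + coreEps2 L β 0 T R σ)) *
          (1 * (Real.exp (2 * β) ^ Fintype.card (Edge 3 L) * ((2 * π ^ 2)⁻¹ * ((1 + ρ ^ 2)⁻¹) ^ 2) ^ Fintype.card (Edge 3 L) *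
              Real.exp (-(2000 * Fintype.card (Plaquette 3 L) * ρ ^ 3 * β)) * (Z * (χlo * Real.exp (-(((96 * (β / 2) + (β)) * (B * r + MT * r ^ 2) * (2 * ((Rin + R₀) + 14 * ((Fintype.card (Edge 3 L) : ℝ)) * ρ ^ 2 + (CL * ((4 + 48 * Ksp) * ρ) * (9 * Ksp * ρ) + MT * (9 * Ksp * ρ) ^ 2)) + (B * r + MT * r ^ 2))) + ((96 * (β / 2) + (β)) * ((CL * ((4 + 48 * Ksp) * ρ) * (9 * Ksp * ρ) + MT * (9 * Ksp * ρ) ^ 2) * (2 * ((Rin + R₀) + 14 * ((Fintype.card (Edge 3 L) : ℝ)) * ρ ^ 2 + (CL * ((4 + 48 * Ksp) * ρ) * (9 * Ksp * ρ) + MT * (9 * Ksp * ρ) ^ 2)) + (CL * ((4 + 48 * Ksp) * ρ) * (9 * Ksp * ρ) + MT * (9 * Ksp * ρ) ^ 2)) + 72 * ((Fintype.card (Edge 3 L) : ℝ)) * ρ ^ 3)))) * (Nlo - ((1 + KD * ((4 + 48 * Ksp) * ρ) ^ 2) * (4 : ℝ) ^ (flatDim L / 2 : ℝ) * Real.exp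 (-((1 / (4 * sliceConst L)) ^ 2 * r ^ 2 / (4 * (powScale 1 β) ^ 2))) * fpWeightBar L (powScale 1 β))))) *
            (Real.exp (-(882 * β * T ^ 2 * Rin ^ 2)) -
              Real.exp (49 * β * Rin ^ 2) * (Real.exp (-(β * (min (ρ - 2 * T) (R₀ - 6 * T ^ 2 * Rin)) ^ 2 / 2)) * (π / (β / 2)) ^ ((Module.finrank ℝ (LinkSpace L) : ℝ) / 2)) /
                stiffGaussTop L (β / 2) β)) *
            (stiffGaussTop L (β / 2) β * Real.exp (-stiffGaussExp L (β / 2) β (linkEmbed L v')))) /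
          (∫ u, χ₀ u * (transferKernel su2Rep ((L : ℝ) ^ 3 * β) (1 : GaugeConfig 3 1 SU2) u / transferKernel su2Rep ((L : ℝ) ^ 3 * β) (1 : GaugeConfig 3 1 SU2) 1)
            ∂configMeasure SU2 1) ≤ fpFibreTransfer L β Ω (coreWeight L ε R₁') (orthoTube L 1 v') 1 ∧
      fpFibreTransfer L β Ω (coreWeight L ε R₁') (orthoTube L 1 v') 1 ≤
        Real.exp (coreEta L β 0 δu T R Γ σ + coreEps1 L β 0 T R + coreEps2 L β 0 T R σ) *
          (1 * (Real.exp (2 * β) ^ Fintype.card (Edge 3 L) * ((2 * π ^ 2)⁻¹) ^ Fintype.card (Edge 3 L) * Real.exp (2000 * Fintype.card (Plaquette 3 L) * ρ ^ 3 * β) *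
                Real.exp (8 * Fintype.card (Edge 3 L) * β * ρ ^ 4) * (Z * Cχ * (Real.exp (((96 * (β / 2) + (β)) * (B * r + MT * r ^ 2) * (2 * (Real.sqrt ((Fintype.card (Edge 3 L) : ℝ)) * ρ + (7 * ((Fintype.card (Edge 3 L) : ℝ)) * ρ + B * (9 * Ksp * ρ) + MT * (9 * Ksp * ρ) ^ 2)) + (B * r + MT * r ^ 2))) + ((96 * (β / 2) + (β)) * ((CL * ((4 + 48 * Ksp) * ρ) * (9 * Ksp * ρ) + MT * (9 * Ksp * ρ) ^ 2) * (2 * (Real.sqrt ((Fintype.card (Edge 3 L) : ℝ)) * ρ + (7 * ((Fintype.card (Edge 3 L) : ℝ)) * ρ + B * (9 * Ksp * ρ) + MT * (9 * Ksp * ρ) ^ 2)) + (CL * ((4 + 48 * Ksp) * ρ) * (9 * Ksp * ρ) + MT * (9 * Ksp * ρ) ^ 2)) + 72 * ((Fintype.card (Edge 3 L) : ℝ)) * ρ ^ 3))) * Nhi + ((1 + KD * ((4 + 48 * Ksp) * ρ) ^ 2) * (4 : ℝ) ^ (flatDim L / 2 : ℝ) * Real.exp (-((1 / (4 * sliceConst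 L)) ^ 2 * r ^ 2 / (4 * (powScale 1 β) ^ 2))) * fpWeightBar L (powScale 1 β)) * Real.exp ((96 * (β / 2) + (β)) * (Real.sqrt ((Fintype.card (Edge 3 L) : ℝ)) * ρ) ^ 2))) * Real.exp (882 * β * T ^ 2 * Rin ^ 2) +
              Cχ * CΩ * 1 * (Real.exp (2 * β) ^ Fintype.card (Edge 3 L) * Real.exp (-(β * ρ ^ 2 / 4))) * Real.exp (49 * β * Rin ^ 2) / stiffGaussTop L (β / 2) β) *
            (stiffGaussTop L (β / 2) β * Real.exp (-stiffGaussExp L (β / 2) β (linkEmbed L v')))) /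
          (∫ u, χ₀ u * (transferKernel su2Rep ((L : ℝ) ^ 3 * β) (1 : GaugeConfig 3 1 SU2) u / transferKernel su2Rep ((L : ℝ) ^ 3 * β) (1 : GaugeConfig 3 1 SU2) 1)
            ∂configMeasure SU2 1) := by
  -- data of `W`
  have hW' : Measurable (coreWeight L ε R₁') := measurable_coreWeight ε R₁'
  have hCW' : ∀ g, |coreWeight L ε R₁' g| ≤ 1 := abs_coreWeight_le ε R₁'
  have hW0' : ∀ g, 0 ≤ coreWeight L ε R₁' g := fun g => (coreWeight_mem_Icc ε R₁' g).1
  have hCχabs : ∀ u, |χ₀ u| ≤ Cχ := fun u => by rw [abs_of_nonneg (hχ0 u)]; exact hCχ u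
  have ht : (0 : ℝ) ≤ β / 2 := by positivity
  have hgm0 : 0 ≤ Z * (χlo * Real.exp (-(((96 * (β / 2) + (β)) * (B * r + MT * r ^ 2) * (2 * ((Rin + R₀) + 14 * ((Fintype.card (Edge 3 L) : ℝ)) * ρ ^ 2 + (CL * ((4 + 48 * Ksp) * ρ) * (9 * Ksp * ρ) + MT * (9 * Ksp * ρ) ^ 2)) + (B * r + MT * r ^ 2))) + ((96 * (β / 2) + (β)) * ((CL * ((4 + 48 * Ksp) * ρ) * (9 * Ksp * ρ) + MT * (9 * Ksp * ρ) ^ 2) * (2 * ((Rin + R₀) + 14 * ((Fintype.card (Edge 3 L) : ℝ)) * ρ ^ 2 + (CL * ((4 + 48 * Ksp) * ρ) * (9 * Ksp * ρ) + MT * (9 * Ksp * ρ) ^ 2)) + (CL * ((4 + 48 * Ksp) * ρ) * (9 * Ksp * ρ) + MT * (9 * Ksp * ρ) ^ 2)) + 72 * ((Fintype.card (Edge 3 L) : ℝ)) * ρ ^ 3)))) * (Nlo - ((1 + KD * ((4 + 48 * Ksp) * ρ) ^ 2) * (4 : ℝ) ^ (flatDim L / 2 : ℝ) * Real.exp (-((1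 / (4 * sliceConst L)) ^ 2 * r ^ 2 / (4 * (powScale 1 β) ^ 2))) * fpWeightBar L (powScale 1 β)))) := by
    have hfb := (fpWeightBar_pos L hs1).le
    have : 0 ≤ Nlo - ((1 + KD * ((4 + 48 * Ksp) * ρ) ^ 2) * (4 : ℝ) ^ (flatDim L / 2 : ℝ) * Real.exp (-((1 / (4 * sliceConst L)) ^ 2 * r ^ 2 / (4 * (powScale 1 β) ^ 2))) * fpWeightBar L (powScale 1 β)) := by linarith
    positivity
  refine central_transfer_two_sided_of_localisedAvg_inner (L := L) hβ hΩm hCΩ hΩ0 hW' hCW' hW0' hδu1 hT0 hT30 hσ0 hσ hΩt hWc hχm hCχabs hχ0 hχw hI0 hv' hv'T hx' hRin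
    hρ (by linarith) hTρ hR₀ hgm0 (fun w hw hnear => ?_) (fun w hw => ?_)
  · -- hAlo from `localisedAvg_chart_lower` with `R_w = R_in + R₀`
    rw [hΩbo]
    have hcwR : ‖chartVec w‖ ≤ Rin + R₀ := by
      calc ‖chartVec w‖ = ‖(chartVec w - linkEmbed L v') + linkEmbed L v'‖ := by rw [sub_add_cancel]
        _ ≤ ‖chartVec w - linkEmbed L v'‖ + ‖linkEmbed L v'‖ := norm_add_le _ _
        _ ≤ R₀ + Rin := add_le_add hnear hx'
        _ = Rin + R₀ := add_comm _ _
    exact localisedAvg_chart_lower (L := L) hL hs1 hKsp hSP hMT hεT hT hC hI hKD hD hB0 hB hCL hLip ht hβ.le hqfm hqf0 hqfinv hqf hχm hχ0 hCχ hχinv hbo ε R₁' hZ0 hZ hNlo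
      hρ.le hρ5 hρε hρK hR50 h1 h2 h3 h4 h5 h6 h7 h8 h9 hδ hρf hρ₁ hr0 hrR hR1 hR1T hcore hsupp hθ hρ4 hχlo0 hχlo hrf hw hcwR ha'3 hboot' hRb3 hRbT hbootb hjump hNT
  · -- hAhi from `localisedAvg_chart_upper`
    rw [hΩbo]
    exact localisedAvg_chart_upper (L := L) hL hs1 hKsp hSP hMT hεT hT hC hI hKD hD hB0 hB hCL hLip ht hβ.le hqfm hqf0 hqfinv hqf rf hχm hχ0 hCχ hχinv hbo ε R₁' hZ0 hZ hNhi
      hρ.le hρ5 hρε hρK hR50 h1 h2 h3 h4 h5 h6 h7 h8 h9 hδ hρf hρ₁ hr0 hrR hR1 hR1T hcore hsupp hθ hw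

end Summit.QuantumFields.YangMills.Theorems.FemtoTransferGap.TwoLattice.ConstTube

end
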